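import Summits.NavierStokesRegularity.NavierStokesRegularity.Theorems.RellichScarSymmetricScarExistsApexScaleInvariantBounds
import Mathlib.Analysis.Calculus.IteratedDeriv.Lemmas
import Mathlib.Analysis.Calculus.MeanValue

/-!
# Crux `SymmetricScarExists` (stmt-NavierStokesRegularity-11718), line `logtime-bernoulli-certificate`:
# stub `stub_apexScaleInvariantBounds` from the decay of the time derivatives
# (registered sub-goal `stub_apexScaleInvariantBounds_ofTimeDerivDecay`)

Helper file (`--supports stmt-NavierStokesRegularity-11718`; theorems only, no definitions, no named
facts), sequel of `…ApexScaleInvariantBounds.lean`, which reduced the registered stub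
`stub_apexScaleInvariantBounds` (scale-invariant regularity of a classical Type-I solution with SOME
classical pressure) to the time regularity of ONE parametric integral, the far potential at the origin
`t ↦ Q₂[v(t)](0) = ∫ D²Γ∞^{1,2}(−y)(v(t,y), v(t,y)) dy` (`stub_apexScaleInvariantBounds_ofFarSmooth`).
Here that integral is differentiated under the integral sign at every order
(`contDiffOn_farPotential_zero_of_decay`), which isolates the genuinely missing analytic input as a
statement about the VELOCITY alone:

* `stub_apexScaleInvariantBounds_ofTimeDerivDecay` (registered sub-goal): if the iterated time derivatives
  of every classical Type-I solution decay like `(1+‖y‖)⁻¹` on compact time windows —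
  `(1+‖y‖)^ε ‖∂ₜʲv(t,y)‖ ≤ M(j, window)` for some `ε = ε(j, window) > 0` — then the stub holds.

Why this is the right residual: the kernel `D²Γ∞ = O(|y|⁻³)` is not integrable at infinity, so SOME decay of
`∂ₜʲ(v ⊗ v)` is necessary to differentiate `Q₂` in time; the tree's quantitative interior regularity
(`NSBoundedHigherRegularityBounds_holds`, `PineauVicol2026.exists_forall_iteratedFDeriv_le_of_typeI`)
controls spatial derivatives only, and time regularity of Navier–Stokes solutions is a property of the
(Riesz) pressure (Serrin's example).  Expected proof of the residual: `∇q = ∇Q[v]` makes `v` a bounded mild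
solution on windows (`IsClassicalNSSolutionOn.isMildNSSolutionOn_holds` + an `L^∞` form of KNSS Lemma 3.1
where the decay of `v` kills the drift), KNSS Prop. 4.1 (`knss2009_smoothing_holds`) bounds all
space–time derivatives, and Landau–Kolmogorov interpolation in `t` transfers the decay of `v` to `∂ₜʲv`
(with exponent `2^{−j}`, whence the `∃ ε > 0` in the hypothesis).

## References

* G. Koch, N. Nadirashvili, G. Seregin, V. Šverák, Acta Math. 203 (2009), Lemma 3.1, Prop. 4.1.
  [KochNadirashviliSereginSverak2009]
* G. Seregin, V. Šverák, Comm. PDE 34 (2009) = arXiv:0804.1803, §2 p. 8. [SereginSverak2009]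
-/

noncomputable section

open MeasureTheory Set Function Filter Topology Metric
open scoped ContDiff

namespace Summit.NavierStokesRegularity.NavierStokesRegularity.Theorems.SymmetricScarExists.LogtimeBernoulli

open Literature.Analysis.FluidPDE
open Literature.Analysis.FluidPDE.FourierNS (HasDecay)
open Literature.Analysis.FluidPDE.PineauVicol2026 (exists_hasDecay_fderiv_newtonFar)

-- nested operator types `ℝ³ →L[ℝ] ℝ³ →L[ℝ] ℝ`
set_option maxSynthPendingDepth 3

section FarTime

variable {v : ℝ → (EuclideanSpace ℝ (Fin 3)) → (EuclideanSpace ℝ (Fin 3))}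

/-- From windowwise decay bounds order by order (each with its own exponent `ε > 0`) to one exponent and
one constant for all orders `i ≤ j`: `‖∂ₜⁱv(t,y)‖ ≤ M (1+‖y‖)^{−ε}` on `[t₁,t₂] × ℝ³` (take the minimum
exponent: `(1+‖y‖)^{−ε}` is decreasing in `ε`). [folklore] -/
theorem uniform_decay_of_decay
    (hdecay : ∀ (j : ℕ) (t₁ t₂ : ℝ), t₁ < t₂ → t₂ < 0 → ∃ ε M : ℝ, 0 < ε ∧ ∀ t ∈ Icc t₁ t₂,
      ∀ y : EuclideanSpace ℝ (Fin 3), (1 + ‖y‖) ^ ε * ‖iteratedDeriv j (fun s => v s y) t‖ ≤ M)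
    (j : ℕ) {t₁ t₂ : ℝ} (h12 : t₁ < t₂) (h2 : t₂ < 0) :
    ∃ ε M : ℝ, 0 < ε ∧ 0 ≤ M ∧ ∀ i ≤ j, ∀ t ∈ Icc t₁ t₂, ∀ y : EuclideanSpace ℝ (Fin 3),
      ‖iteratedDeriv i (fun s => v s y) t‖ ≤ M * (1 + ‖y‖) ^ (-ε) := by
  -- a decay bound with exponent `ε` implies one with any smaller positive exponent
  have hweak : ∀ {ε ε' M : ℝ} {a : ℝ} (y : EuclideanSpace ℝ (Fin 3)), ε' ≤ ε → 0 ≤ M →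
      (1 + ‖y‖) ^ ε * a ≤ M → 0 ≤ a → a ≤ M * (1 + ‖y‖) ^ (-ε') := by
    intro ε ε' M a y hε hM h ha
    have h1 : (1 : ℝ) ≤ 1 + ‖y‖ := le_add_of_nonneg_right (norm_nonneg _)
    have hpos : 0 < (1 + ‖y‖) ^ ε := Real.rpow_pos_of_pos (by positivity) ε
    have h2 : a ≤ M * (1 + ‖y‖) ^ (-ε) := by
      rw [Real.rpow_neg (by positivity), ← div_eq_mul_inv, le_div_iff₀ hpos, mul_comm]
      exact h
    exact h2.trans (mul_le_mul_of_nonneg_left (Real.rpow_le_rpow_of_exponent_le h1 (by linarith)) hM)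
  induction j with
  | zero =>
    obtain ⟨ε, M, hε, hM⟩ := hdecay 0 t₁ t₂ h12 h2
    refine ⟨ε, max M 0, hε, le_max_right _ _, fun i hi t ht y => ?_⟩
    obtain rfl : i = 0 := Nat.le_zero.1 hi
    exact hweak y le_rfl (le_max_right _ _) ((hM t ht y).trans (le_max_left _ _)) (norm_nonneg _)
  | succ j ih =>
    obtain ⟨ε, M, hε, hM0, hM⟩ := ih
    obtain ⟨ε', M', hε', hM'⟩ := hdecay (j + 1) t₁ t₂ h12 h2
    refine ⟨min ε ε', max M M', lt_min hε hε', le_max_of_le_left hM0, fun i hi t ht y => ?_⟩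
    have h1 : (1 : ℝ) ≤ 1 + ‖y‖ := le_add_of_nonneg_right (norm_nonneg _)
    rcases Nat.lt_or_eq_of_le hi with hlt | heq
    · calc ‖iteratedDeriv i (fun s => v s y) t‖ ≤ M * (1 + ‖y‖) ^ (-ε) := hM i (Nat.lt_succ_iff.1 hlt) t ht y
        _ ≤ max M M' * (1 + ‖y‖) ^ (-min ε ε') :=
          mul_le_mul (le_max_left _ _) (Real.rpow_le_rpow_of_exponent_le h1 (neg_le_neg (min_le_left _ _)))
            (by positivity) (le_max_of_le_left hM0)
    · subst heq
      exact hweak y (min_le_right _ _) (le_max_of_le_left hM0)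
        ((hM' t ht y).trans (le_max_right _ _)) (norm_nonneg _)

/-- **The far potential at the origin is smooth in time when the time derivatives of the field decay.**
For `v` jointly smooth on `(−∞,0) × ℝ³` whose iterated time derivatives obey, on every compact window
`[t₁,t₂] ⊂ (−∞,0)`, `(1+‖y‖)^ε ‖∂ₜʲv(t,y)‖ ≤ M` for SOME `ε = ε(j, window) > 0`, the function
`t ↦ Q₂[v(t)](0) = ∫ D²Γ∞(−y)(v(t,y), v(t,y)) dy` is `C^∞` on `(−∞,0)`: the `j`-th time derivative of the
integrand is bounded on windows by `‖D²Γ∞(−y)‖ Σᵢ C(j,i)‖∂ₜⁱv‖‖∂ₜ^{j−i}v‖ ≤ M₀ 2ʲ M² (1+‖y‖)^{−3−2ε} ∈ L¹(ℝ³)`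
(Leibniz bound for bilinear maps `ContinuousLinearMap.norm_iteratedFDerivWithin_le_of_bilinear`; decay
`(1+|z|)⁻³` of `D²Γ∞`, `PineauVicol2026.exists_hasDecay_fderiv_newtonFar`; Mathlib's `integrable_one_add_norm`),
so one differentiates under the integral sign at every order (`hasDerivAt_integral_of_dominated_loc_of_deriv_le`)
and `contDiffOn_of_differentiableOn_deriv` concludes. [folklore] -/
theorem contDiffOn_farPotential_zero_of_decay (hv : IsSmoothSpaceTimeOn (Iio 0) v)
    (hdecay : ∀ (j : ℕ) (t₁ t₂ : ℝ), t₁ < t₂ → t₂ < 0 → ∃ ε M : ℝ, 0 < ε ∧ ∀ t ∈ Icc t₁ t₂,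
      ∀ y : EuclideanSpace ℝ (Fin 3), (1 + ‖y‖) ^ ε * ‖iteratedDeriv j (fun s => v s y) t‖ ≤ M) :
    ContDiffOn ℝ ∞ (fun t => farPotential 1 2 (v t) 0) (Iio 0) := by
  set Φ := fderiv ℝ (fderiv ℝ (newtonFar (1 : ℝ) 2)) with hΦ
  obtain ⟨⟨M₀, hM₀⟩, -, -⟩ := exists_hasDecay_fderiv_newtonFar (r₀ := (1 : ℝ)) (r₁ := 2) one_pos one_lt_two
  have hΓ : ContDiff ℝ ∞ (newtonFar (1 : ℝ) 2) := contDiff_newtonFar one_pos one_lt_two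
  have hΦs : ContDiff ℝ ∞ Φ :=
    (hΓ.fderiv_right (m := ∞) le_rfl).fderiv_right (m := ∞) le_rfl
  -- the integrand and its iterated time derivatives
  set G : ℕ → ℝ → (EuclideanSpace ℝ (Fin 3)) → ℝ := fun j t y =>
    iteratedDeriv j (fun s => Φ (0 - y) (v s y) (v s y)) t with hG
  have hG0 : G 0 = fun t y => Φ (0 - y) (v t y) (v t y) := by
    funext t y; simp only [hG, iteratedDeriv_zero]
  have hGsucc : ∀ j, G (j + 1) = fun t y => deriv (fun s => G j s y) t := by
    intro j; funext t y; simp only [hG, iteratedDeriv_succ]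
  -- (1) joint smoothness of every `G j` on `t < 0`
  have hGsm : ∀ j, IsSmoothSpaceTimeOn (Iio 0) (G j) := by
    intro j
    induction j with
    | zero =>
      rw [hG0]
      have h1 : ContDiffOn ℝ ∞ (fun p : ℝ × EuclideanSpace ℝ (Fin 3) => Φ (0 - p.2))
          (Iio (0 : ℝ) ×ˢ (univ : Set (EuclideanSpace ℝ (Fin 3)))) :=
        (hΦs.comp (contDiff_const.sub contDiff_snd)).contDiffOn
      exact (h1.clm_apply hv).clm_apply hv
    | succ j ih =>
      rw [hGsucc j]
      exact ih.isSmoothSpaceTimeOn_deriv isOpen_Iio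
  -- (2) pointwise time derivatives
  have hGderiv : ∀ j, ∀ t < (0 : ℝ), ∀ y, HasDerivAt (fun s => G j s y) (G (j + 1) t y) t := by
    intro j t ht y
    have h := (hGsm j).hasDerivAt_timeLine isOpen_Iio ht y
    rw [hGsucc j]
    exact h
  -- (3) bounds on windows: `‖G j t y‖ ≤ D (1+‖y‖)^{-(3+2ε)}`
  have hGbound : ∀ (j : ℕ) (t₁ t₂ : ℝ), t₁ < t₂ → t₂ < 0 → ∃ ε D : ℝ, 0 < ε ∧ 0 ≤ D ∧ ∀ t ∈ Icc t₁ t₂,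
      ∀ y : EuclideanSpace ℝ (Fin 3), ‖G j t y‖ ≤ D * (1 + ‖y‖) ^ (-(3 + 2 * ε)) := by
    intro j t₁ t₂ h12 h2
    obtain ⟨ε, M, hε, hM0, hM⟩ := uniform_decay_of_decay hdecay j h12 h2
    refine ⟨ε, M₀ * (2 ^ j * M ^ 2), hε, by have := hM₀.nonneg; positivity, fun t ht y => ?_⟩
    have ht0 : t < 0 := lt_of_le_of_lt ht.2 h2
    set f : ℝ → EuclideanSpace ℝ (Fin 3) := fun s => v s y with hf
    have hfs : ContDiffOn ℝ ∞ f (Iio 0) :=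
      hv.comp (contDiffOn_id.prodMk contDiffOn_const) fun s hs => mk_mem_prod hs (mem_univ _)
    have hU : UniqueDiffOn ℝ (Iio (0 : ℝ)) := uniqueDiffOn_Iio 0
    have hW : ∀ i, iteratedDeriv i f t = iteratedDerivWithin i f (Iio 0) t := fun i =>
      (iteratedDerivWithin_of_isOpen isOpen_Iio ht0).symm
    have hGW : G j t y = iteratedDerivWithin j (fun s => Φ (0 - y) (f s) (f s)) (Iio 0) t := by
      simp only [hG, hf]
      exact (iteratedDerivWithin_of_isOpen isOpen_Iio ht0).symm
    rw [hGW, ← norm_iteratedFDerivWithin_eq_norm_iteratedDerivWithin]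
    refine (ContinuousLinearMap.norm_iteratedFDerivWithin_le_of_bilinear (Φ (0 - y)) hfs hfs hU ht0
      (by exact_mod_cast le_top)).trans ?_
    set w : ℝ := (1 + ‖y‖) ^ (-ε) with hw
    have hw0 : 0 ≤ w := by rw [hw]; positivity
    have hterm : ∀ i ∈ Finset.range (j + 1),
        (j.choose i : ℝ) * ‖iteratedFDerivWithin ℝ i f (Iio 0) t‖ *
          ‖iteratedFDerivWithin ℝ (j - i) f (Iio 0) t‖ ≤ (j.choose i : ℝ) * (M * w) * (M * w) := by
      intro i hi
      have hi' : i ≤ j := Nat.lt_succ_iff.1 (Finset.mem_range.1 hi)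
      rw [norm_iteratedFDerivWithin_eq_norm_iteratedDerivWithin, norm_iteratedFDerivWithin_eq_norm_iteratedDerivWithin,
        ← hW, ← hW]
      exact mul_le_mul (mul_le_mul_of_nonneg_left (hM i hi' t ht y) (Nat.cast_nonneg _))
        (hM (j - i) (Nat.sub_le _ _) t ht y) (norm_nonneg _) (mul_nonneg (Nat.cast_nonneg _) (by positivity))
    have hsum : ∑ i ∈ Finset.range (j + 1), (j.choose i : ℝ) = 2 ^ j := by
      have := Nat.sum_range_choose j; exact_mod_cast this
    have h1y : 0 < 1 + ‖y‖ := by positivity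
    -- the kernel decay in `rpow` form
    have hker : ‖Φ (0 - y)‖ ≤ M₀ * (1 + ‖y‖) ^ (-(3 : ℝ)) := by
      have h := hM₀ (0 - y)
      rw [zero_sub, norm_neg] at h
      rw [zero_sub]
      calc ‖Φ (-y)‖ ≤ M₀ * ((1 + ‖y‖) ^ 3)⁻¹ := h
        _ = M₀ * (1 + ‖y‖) ^ (-(3 : ℝ)) := by
            rw [Real.rpow_neg h1y.le, show (3 : ℝ) = ((3 : ℕ) : ℝ) by norm_num, Real.rpow_natCast]
    have hww : (1 + ‖y‖) ^ (-(3 : ℝ)) * (w * w) = (1 + ‖y‖) ^ (-(3 + 2 * ε)) := by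
      rw [hw, ← Real.rpow_add h1y, ← Real.rpow_add h1y]
      congr 1; ring
    calc ‖Φ (0 - y)‖ * ∑ i ∈ Finset.range (j + 1), (j.choose i : ℝ) * ‖iteratedFDerivWithin ℝ i f (Iio 0) t‖ *
          ‖iteratedFDerivWithin ℝ (j - i) f (Iio 0) t‖
        ≤ (M₀ * (1 + ‖y‖) ^ (-(3 : ℝ))) * ∑ i ∈ Finset.range (j + 1), (j.choose i : ℝ) * (M * w) * (M * w) :=
          mul_le_mul hker (Finset.sum_le_sum hterm) (Finset.sum_nonneg fun i _ => by positivity)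
            (by have := hM₀.nonneg; positivity)
      _ = M₀ * (2 ^ j * M ^ 2) * ((1 + ‖y‖) ^ (-(3 : ℝ)) * (w * w)) := by
          rw [← Finset.sum_mul, ← Finset.sum_mul, hsum]; ring
      _ = M₀ * (2 ^ j * M ^ 2) * (1 + ‖y‖) ^ (-(3 + 2 * ε)) := by rw [hww]
  -- integrability of the dominators
  have hintw : ∀ {ε : ℝ}, 0 < ε → Integrable (fun y : EuclideanSpace ℝ (Fin 3) => (1 + ‖y‖) ^ (-(3 + 2 * ε)))
      (volume : Measure (EuclideanSpace ℝ (Fin 3))) := by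
    intro ε hε
    exact integrable_one_add_norm (by
      simp only [finrank_euclideanSpace, Fintype.card_fin, Nat.cast_ofNat]; linarith)
  -- (4) differentiation under the integral sign
  set F : ℕ → ℝ → ℝ := fun j t => ∫ y, G j t y with hF
  have hFderiv : ∀ j, ∀ t₀ < (0 : ℝ), HasDerivAt (F j) (F (j + 1) t₀) t₀ := by
    intro j t₀ ht₀
    set t₁ : ℝ := t₀ - 1 with ht₁
    set t₂ : ℝ := t₀ / 2 with ht₂
    have h12 : t₁ < t₂ := by rw [ht₁, ht₂]; linarith
    have h2 : t₂ < 0 := by rw [ht₂]; linarith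
    have hwin : Ioo t₁ t₂ ∈ 𝓝 t₀ := Ioo_mem_nhds (by rw [ht₁]; linarith) (by rw [ht₂]; linarith)
    obtain ⟨ε, D, hε, hD0, hD⟩ := hGbound j t₁ t₂ h12 h2
    obtain ⟨ε', D', hε', hD'0, hD'⟩ := hGbound (j + 1) t₁ t₂ h12 h2
    have hmeas : ∀ k, ∀ t < (0 : ℝ), AEStronglyMeasurable (G k t) volume := fun k t ht =>
      ((hGsm k).contDiff_slice ht).continuous.aestronglyMeasurable
    have hint : Integrable (G j t₀) volume :=
      Integrable.mono' ((hintw hε).const_mul D) (hmeas j t₀ ht₀)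
        (Eventually.of_forall fun y => hD t₀ ⟨by rw [ht₁]; linarith, by rw [ht₂]; linarith⟩ y)
    have key := hasDerivAt_integral_of_dominated_loc_of_deriv_le (μ := (volume : Measure (EuclideanSpace ℝ (Fin 3))))
      (F := G j) (F' := G (j + 1)) (x₀ := t₀) (bound := fun y => D' * (1 + ‖y‖) ^ (-(3 + 2 * ε'))) hwin
      (by filter_upwards [Iio_mem_nhds ht₀] with t ht; exact hmeas j t ht)
      hint (hmeas (j + 1) t₀ ht₀)
      (Eventually.of_forall fun y t ht => hD' t (Ioo_subset_Icc_self ht) y)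
      ((hintw hε').const_mul D')
      (Eventually.of_forall fun y t ht => hGderiv j t (ht.2.trans h2) y)
    exact key.2
  -- (5) all iterated derivatives within `Iio 0`
  have hiter : ∀ m : ℕ, EqOn (iteratedDerivWithin m (F 0) (Iio 0)) (F m) (Iio 0) := by
    intro m
    induction m with
    | zero => intro t _; rw [iteratedDerivWithin_zero]
    | succ m ih =>
      intro t ht
      rw [iteratedDerivWithin_succ, derivWithin_congr ih (ih ht), derivWithin_of_isOpen isOpen_Iio ht]
      exact (hFderiv m t ht).deriv
  have hsmooth : ContDiffOn ℝ ∞ (F 0) (Iio 0) := by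
    refine contDiffOn_of_differentiableOn_deriv fun m _ => ?_
    refine DifferentiableOn.congr (f := F m) (fun t ht => ?_) (hiter m)
    exact (hFderiv m t ht).differentiableAt.differentiableWithinAt
  -- (6) `F 0` is the far potential at the origin
  refine hsmooth.congr fun t _ => ?_
  simp only [hF, hG0, farPotential, hΦ]



/-- **Registered sub-goal `stub_apexScaleInvariantBounds_ofTimeDerivDecay`: the stub from the decay at
spatial infinity of the time derivatives of classical Type-I solutions.**  If every classical solution
`(v, q)` of Navier–Stokes (`ν = 1`, `f = 0`) on `(−∞,0) × ℝ³` with the Type-I bound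
`‖v(t,x)‖ ≤ C/(‖x‖+√(−t))` satisfies, for every order `j` and every window `[t₁,t₂] ⊂ (−∞,0)`,
`(1+‖y‖)^ε ‖∂ₜʲv(t,y)‖ ≤ M` for some `ε > 0` (`j = 0` is the Type-I bound itself; `j ≥ 1` is the missing
analytic input — e.g. bounded mild solutions have bounded space–time derivatives of all orders, KNSS 2009
Prop. 4.1, and Landau–Kolmogorov interpolation in time transfers the decay of `v`, halving the exponent at
each order), then the stub `stub_apexScaleInvariantBounds` holds (`contDiffOn_farPotential_zero_of_decay` and
`stub_apexScaleInvariantBounds_ofFarSmooth`). [cite: SereginSverak2009, §2 p. 8] -/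
theorem stub_apexScaleInvariantBounds_ofTimeDerivDecay :
    (∀ (v : ℝ → EuclideanSpace ℝ (Fin 3) → EuclideanSpace ℝ (Fin 3)) (q : ℝ → EuclideanSpace ℝ (Fin 3) → ℝ) (C : ℝ), Literature.Analysis.FluidPDE.IsClassicalNSSolutionOn (Set.Iio 0) 1 0 v q → Literature.Analysis.FluidPDE.HasTypeIDecay C v → ∀ (j : ℕ) (t₁ t₂ : ℝ), t₁ < t₂ → t₂ < 0 → ∃ (ε M : ℝ), 0 < ε ∧ ∀ t ∈ Set.Icc t₁ t₂, ∀ (y : EuclideanSpace ℝ (Fin 3)), (1 + ‖y‖) ^ ε * ‖iteratedDeriv j (fun s => v s y) t‖ ≤ M) → ∀ (v : ℝ → EuclideanSpace ℝ (Fin 3) → EuclideanSpace ℝ (Fin 3)) (q : ℝ → EuclideanSpace ℝ (Fin 3) → ℝ) (C : ℝ), Literature.Analysis.FluidPDE.IsClassicalNSSolutionOn (Set.Iio 0) 1 0 v q → Literature.Analysis.FluidPDE.HasTypeIDecay C v → ∃ (q' : ℝ → EuclideanSpace ℝ (Fin 3) → ℝ) (K : ℝ), Literature.Analysis.FluidPDE.IsClassicalNSSolutionOn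 (Set.Iio 0) 1 0 v q' ∧ ∀ t < (0 : ℝ), ∀ (x : EuclideanSpace ℝ (Fin 3)), (‖x‖ + Real.sqrt (-t)) ^ 2 * ‖fderiv ℝ (v t) x‖ ≤ K ∧ (‖x‖ + Real.sqrt (-t)) ^ 3 * ‖iteratedFDeriv ℝ 2 (v t) x‖ ≤ K ∧ (‖x‖ + Real.sqrt (-t)) ^ 2 * |q' t x| ≤ K ∧ (‖x‖ + Real.sqrt (-t)) ^ 3 * ‖gradient (q' t) x‖ ≤ K ∧ (‖x‖ + Real.sqrt (-t)) ^ 3 * ‖Literature.Analysis.FluidPDE.timeDeriv v t x‖ ≤ K ∧ (‖x‖ + Real.sqrt (-t)) ^ 4 * ‖fderiv ℝ (Literature.Analysis.FluidPDE.timeDeriv v t) x‖ ≤ K :=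
  fun hTD => stub_apexScaleInvariantBounds_ofFarSmooth fun v q C hsol hdec =>
    contDiffOn_farPotential_zero_of_decay hsol.smooth_velocity (hTD v q C hsol hdec)

end FarTime

/-! ### A tool for the residual: Landau's inequality on an interval -/

/-- **Landau's inequality on an interval (vector-valued)**: if `f : ℝ → E` has `‖f‖ ≤ A` and `‖f″‖ ≤ B`
on `[a, b]` (derivatives `f′`, `f″` in the `HasDerivAt` sense on `[a, b]`), then for every `0 < h` with
`2h ≤ b − a` and every `t ∈ [a, b]`, `‖f′(t)‖ ≤ 2A/h + 2Bh` (linearise `g(s) = f(s) − (s − t)f′(t)` on the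
half of `[t − h, t + h]` inside `[a, b]`; two mean value inequalities).  With `h = min{(b−a)/2, √(A/B)}` this
is the Landau–Kolmogorov interpolation `‖f′‖ ≲ √(AB) + A/(b−a)` by which bounded `∂ₜ^{j+1}v` and decaying
`∂ₜ^{j−1}v` give decaying `∂ₜʲv` (halving the exponent), the intended route to the hypothesis of
`stub_apexScaleInvariantBounds_ofTimeDerivDecay`. [folklore] -/
theorem norm_deriv_le_of_norm_le_of_norm_deriv_two_le {E : Type*} [NormedAddCommGroup E] [NormedSpace ℝ E]
    {f f' f'' : ℝ → E} {a b : ℝ} (hf : ∀ s ∈ Icc a b, HasDerivAt f (f' s) s)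
    (hf' : ∀ s ∈ Icc a b, HasDerivAt f' (f'' s) s) {A B : ℝ} (hA : ∀ s ∈ Icc a b, ‖f s‖ ≤ A)
    (hB : ∀ s ∈ Icc a b, ‖f'' s‖ ≤ B) {h : ℝ} (hh : 0 < h) (hh2 : 2 * h ≤ b - a) {t : ℝ}
    (ht : t ∈ Icc a b) : ‖f' t‖ ≤ 2 * A / h + 2 * B * h := by
  have hB0 : 0 ≤ B := (norm_nonneg _).trans (hB a ⟨le_rfl, by linarith [ht.1, ht.2]⟩)
  have hBhh : 0 ≤ B * h * h := by positivity
  -- the linearisation `g s = f s - (s - t) • f' t`, with derivative `f' s - f' t`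
  set g : ℝ → E := fun s => f s - (s - t) • f' t with hg
  have hgd : ∀ {c d : ℝ}, Icc c d ⊆ Icc a b → ∀ s ∈ Icc c d,
      HasDerivWithinAt g (f' s - f' t) (Icc c d) s := by
    intro c d hsub s hs
    have h1 : HasDerivAt (fun s : ℝ => (s - t) • f' t) ((1 : ℝ) • f' t) s :=
      ((hasDerivAt_id s).sub_const t).smul_const (f' t)
    rw [one_smul] at h1
    exact ((hf s (hsub hs)).sub h1).hasDerivWithinAt
  -- `‖f' s - f' c‖ ≤ B (s - c)` on any `[c, d] ⊆ [a, b]`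
  have hD : ∀ {c d : ℝ}, Icc c d ⊆ Icc a b → ∀ s ∈ Icc c d, ‖f' s - f' c‖ ≤ B * (s - c) :=
    fun hsub => norm_image_sub_le_of_norm_deriv_le_segment'
      (fun s hs => (hf' s (hsub hs)).hasDerivWithinAt) (fun s hs => hB s (hsub (Ico_subset_Icc_self hs)))
  -- conclusion from an estimate `h ‖f' t‖ ≤ 2A + 2Bh²`
  have hend : h * ‖f' t‖ ≤ 2 * A + 2 * B * h * h → ‖f' t‖ ≤ 2 * A / h + 2 * B * h := by
    intro h3
    rw [div_add' _ _ _ hh.ne', le_div_iff₀ hh]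
    linarith
  by_cases hcase : t + h ≤ b
  · -- forward interval `[t, t + h]`
    have hsub : Icc t (t + h) ⊆ Icc a b := Icc_subset_Icc ht.1 hcase
    have hgb : ∀ s ∈ Ico t (t + h), ‖f' s - f' t‖ ≤ B * h := fun s hs =>
      (hD hsub s (Ico_subset_Icc_self hs)).trans (mul_le_mul_of_nonneg_left (by linarith [hs.2]) hB0)
    have key := norm_image_sub_le_of_norm_deriv_le_segment' (hgd hsub) hgb (t + h) ⟨by linarith, le_rfl⟩
    have e : g (t + h) - g t = f (t + h) - f t - h • f' t := by
      simp only [hg, add_sub_cancel_left, sub_self, zero_smul, sub_zero]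
      abel
    rw [e, show t + h - t = h by ring] at key
    refine hend ?_
    calc h * ‖f' t‖ = ‖h • f' t‖ := by rw [norm_smul, Real.norm_of_nonneg hh.le]
      _ = ‖(f (t + h) - f t) - (f (t + h) - f t - h • f' t)‖ := by congr 1; abel
      _ ≤ ‖f (t + h) - f t‖ + ‖f (t + h) - f t - h • f' t‖ := norm_sub_le _ _
      _ ≤ (‖f (t + h)‖ + ‖f t‖) + B * h * h := add_le_add (norm_sub_le _ _) key
      _ ≤ (A + A) + B * h * h := by
          gcongr
          · exact hA _ (hsub ⟨by linarith, le_rfl⟩)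
          · exact hA _ ht
      _ ≤ 2 * A + 2 * B * h * h := by linarith
  · -- backward interval `[t - h, t]`
    have hta : a ≤ t - h := by linarith [ht.1, ht.2, not_le.1 hcase]
    have hsub : Icc (t - h) t ⊆ Icc a b := Icc_subset_Icc hta ht.2
    have hgb : ∀ s ∈ Ico (t - h) t, ‖f' s - f' t‖ ≤ 2 * B * h := by
      intro s hs
      have h1 := hD hsub s (Ico_subset_Icc_self hs)
      have h2 := hD hsub t ⟨by linarith, le_rfl⟩
      have hs' : s - (t - h) ≤ h := by linarith [hs.2]
      calc ‖f' s - f' t‖ = ‖(f' s - f' (t - h)) - (f' t - f' (t - h))‖ := by congr 1; abel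
        _ ≤ ‖f' s - f' (t - h)‖ + ‖f' t - f' (t - h)‖ := norm_sub_le _ _
        _ ≤ B * (s - (t - h)) + B * (t - (t - h)) := add_le_add h1 h2
        _ ≤ B * h + B * h := add_le_add (mul_le_mul_of_nonneg_left hs' hB0) (by rw [sub_sub_cancel])
        _ = 2 * B * h := by ring
    have key := norm_image_sub_le_of_norm_deriv_le_segment' (hgd hsub) hgb t ⟨by linarith, le_rfl⟩
    have e : g t - g (t - h) = f t - f (t - h) - h • f' t := by
      simp only [hg, sub_self, zero_smul, sub_zero]
      rw [show t - h - t = -h by ring, neg_smul]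
      abel
    rw [e, show t - (t - h) = h by ring] at key
    refine hend ?_
    calc h * ‖f' t‖ = ‖h • f' t‖ := by rw [norm_smul, Real.norm_of_nonneg hh.le]
      _ = ‖(f t - f (t - h)) - (f t - f (t - h) - h • f' t)‖ := by congr 1; abel
      _ ≤ ‖f t - f (t - h)‖ + ‖f t - f (t - h) - h • f' t‖ := norm_sub_le _ _
      _ ≤ (‖f t‖ + ‖f (t - h)‖) + 2 * B * h * h := add_le_add (norm_sub_le _ _) key
      _ ≤ (A + A) + 2 * B * h * h := by
          gcongr
          · exact hA _ ht
          · exact hA _ (hsub ⟨le_rfl, by linarith⟩)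
      _ = 2 * A + 2 * B * h * h := by ring

end Summit.NavierStokesRegularity.NavierStokesRegularity.Theorems.SymmetricScarExists.LogtimeBernoulli
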